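import Summits.HubbardSuperconductivity.HubbardSuperconductivity.Theses.InfiniteVolumeFirst
import Summits.HubbardSuperconductivity.HubbardSuperconductivity.Theorems.InfiniteVolumeFirstTightnessExchange
import Summits.HubbardSuperconductivity.HubbardSuperconductivity.Theorems.WindowInfraredBound.Negative.LoadBearing
import Literature.Barriers.HubbardSuperconductivity.PureModelStripeCompetitionProofs
import Literature.MathematicalPhysics.QuantumLattice.PairCorrelationsProofs

/-!
# Crux `NoInfraredPileUp` (item `stmt-HubbardSuperconductivity-18534`, route InfiniteVolumeFirst rank 3):
# the momentum cut `m ≠ 0` is load-bearing — WITH the zero mode the crux contradicts the route's rank-2 crux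

`not_noInfraredPileUpWithZeroMode_of_noNormalLimitState`.  The crux bounds the window tail
`T_ε(ψ_L) = Σ_{m ≠ 0, |q_m| ≤ ε} S_{ψ_L}(m)` of the `d`-wave pair structure factor of weak-coupling
ground-state families SOFTLY (`∀ η ∃ ε ∃ L₀ …  ≤ η L²`).  Admit the zero mode into the window (drop `m ≠ 0`)
and the statement says in particular `S_{ψ_L}(0) ≤ η L²` eventually for every `η`, i.e. the pair-field
long-range-order sequence `LRO_L = S_L(0)/L² = L⁻⁴ Re⟨Δ_d ψ_L, Δ_d ψ_L⟩` of EVERY admissible ground-state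
family tends to `0` at every weak coupling — while the route's rank-2 crux `NoNormalLimitState` together
with the LANDED exchange lemma `infiniteVolumeFirst_tightnessExchange_proof` (item 18535) and the original
tightness (implied by the mutated one, the window only grows) produce `liminf_k LRO_{2k} > 0` for the same
family.  Admissible families exist at every `(U, δ)` (`exists_unit_isGroundStateInSector_hubbardTorus`), so:

  `NoNormalLimitState → ¬ NoInfraredPileUpWithZeroMode`   (kernel-checked, no physics input).

Reading for provers: the crux is an infrared statement AROUND the condensate, never on it; any envelope
`S_ψ(q) ≤ f(q)` a proof produces must be allowed to fail at `q = 0` (where the route wants `Θ(L²)`), so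
arguments bounding `Σ_{|q| ≤ ε} S` through a quantity continuous at `q = 0` (total pair number in a ball,
`ρ₂`-eigenvalue sums over a momentum ball, susceptibility sum rules including the uniform mode) are dead on
arrival for this route.  Companion of `Cruxes/NoInfraredPileUp/Disproof.lean` §3 (standing disprover,
cdisprove cycle 1).  Sources: D. J. Scalapino, Phys. Rep. 250 (1995) 329, §2 (pair-field LRO);
T. Kennedy, E. H. Lieb, B. S. Shastry, PRL 61 (1988) 2582 (zero mode vs. `p ≠ 0` modes of an order
operator); C. N. Yang, Rev. Mod. Phys. 34 (1962) 694, §4.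
-/

-- the mandated namespace `Summit.<Summit>.<Problem>.Theorems` repeats `HubbardSuperconductivity`
-- (single-problem summit, D-0017), which the `dupNamespace` linter flags on every declaration
set_option linter.dupNamespace false

noncomputable section

namespace Summit.HubbardSuperconductivity.HubbardSuperconductivity.Theorems.NoInfraredPileUp.Negative

open Literature.MathematicalPhysics.QuantumLattice Literature.Probability.LatticeModels
  Literature.Barriers.HubbardSuperconductivity Matrix Finset Filter
open Summit.HubbardSuperconductivity.HubbardSuperconductivity.Theorems.WindowInfraredBound.Negative
open Summit.HubbardSuperconductivity.HubbardSuperconductivity.Theses.InfiniteVolumeFirst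
open scoped ComplexOrder Topology

/-- **The momentum cut `m ≠ 0` of `NoInfraredPileUp` is load-bearing for the route.**  The rank-2 crux
`NoNormalLimitState` REFUTES the rank-3 crux with the zero mode admitted into the window (the negated
statement is `InfiniteVolumeFirst.NoInfraredPileUp` verbatim except that the summand's guard
`m ≠ 0 ∧ momentumNormSq L m ≤ ε ^ 2` is replaced by `momentumNormSq L m ≤ ε ^ 2`; spelled out, no
definition introduced).  Proof: fix the `δ` of `NoNormalLimitState`, the `U₁` of the mutated crux at `δ`,
the `U < U₁` of `NoNormalLimitState`, and any admissible ground-state family `ψ` at `(U, δ)` (choice over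
`exists_unit_isGroundStateInSector_hubbardTorus`); the mutated tightness implies the original one, so the
landed exchange lemma and the atom property give `0 < liminf_k LRO_{2k}`; but the zero mode lies in every
window (`pairStructureFactor_zero_le_windowSumWithZero`), so `LRO_{2k} = S_{2k}(0)/(2k)² ≤ η` eventually
for every `η > 0` (`torusLROSeq_pairFieldCorr_succ`, `pairStructureFactor_zero`), whence `liminf ≤ 0`.
Scalapino, Phys. Rep. 250 (1995) 329, §2; Kennedy–Lieb–Shastry, PRL 61 (1988) 2582. [folklore] -/
theorem not_noInfraredPileUpWithZeroMode_of_noNormalLimitState (h1 : NoNormalLimitState) :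
    ¬ (∀ δ ∈ Set.Ioo (0:ℝ) (1 / 2), ∃ U₁ : ℝ, 0 < U₁ ∧ ∀ U ∈ Set.Ioo (0:ℝ) U₁,
        ∀ (N : ℕ → ℕ) (ψ : ∀ L, Fock (Orb (FermionTorus 2 L))),
          (∀ L, Even L → N L = 2 * ⌊(1 - δ) * (L : ℝ) ^ 2 / 2⌋₊ ∧ star (ψ L) ⬝ᵥ ψ L = 1 ∧
              IsGroundStateInSector (hubbardTorus 2 L 1 U) (N L) 0 (ψ L)) →
            ∀ η : ℝ, 0 < η → ∃ ε : ℝ, 0 < ε ∧ ∃ L₀ : ℕ, ∀ (L : ℕ) [NeZero L], Even L → L₀ ≤ L →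
              (∑ m : Fin 2 → ZMod L, if momentumNormSq L m ≤ ε ^ 2 then
                  pairStructureFactor dWaveFormFactor L (ψ L) m else 0) ≤ η * (L : ℝ) ^ 2) := by
  intro h2
  obtain ⟨δ, hδ, h1'⟩ := h1
  obtain ⟨U₁, hU₁, h2'⟩ := h2 δ hδ
  obtain ⟨U, hU, hA⟩ := h1' U₁ hU₁
  have hδ1 : (-1 : ℝ) ≤ δ := by linarith [hδ.1]
  -- an admissible ground-state family at `(U, δ)`
  have key : ∀ L : ℕ, ∃ φ : Fock (Orb (FermionTorus 2 L)), star φ ⬝ᵥ φ = 1 ∧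
      IsGroundStateInSector (hubbardTorus 2 L 1 U) (2 * ⌊(1 - δ) * (L : ℝ) ^ 2 / 2⌋₊) 0 φ := fun L =>
    exists_unit_isGroundStateInSector_hubbardTorus U L _ (natFloor_filling_le_sq hδ1 L)
  choose ψ hψ using key
  have hadm : ∀ L, Even L → (fun L : ℕ => 2 * ⌊(1 - δ) * (L : ℝ) ^ 2 / 2⌋₊) L =
        2 * ⌊(1 - δ) * (L : ℝ) ^ 2 / 2⌋₊ ∧ star (ψ L) ⬝ᵥ ψ L = 1 ∧
      IsGroundStateInSector (hubbardTorus 2 L 1 U)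
        ((fun L : ℕ => 2 * ⌊(1 - δ) * (L : ℝ) ^ 2 / 2⌋₊) L) 0 (ψ L) :=
    fun L _ => ⟨rfl, (hψ L).1, (hψ L).2⟩
  have hZ := h2' U hU _ ψ hadm
  -- (i) the original tightness follows: the window only grows when the zero mode is admitted
  have htight : ∀ η : ℝ, 0 < η → ∃ ε : ℝ, 0 < ε ∧ ∃ L₀ : ℕ, ∀ (L : ℕ) [NeZero L], Even L → L₀ ≤ L →
      (∑ m : Fin 2 → ZMod L, if m ≠ 0 ∧ momentumNormSq L m ≤ ε ^ 2 then
          pairStructureFactor dWaveFormFactor L (ψ L) m else 0) ≤ η * (L : ℝ) ^ 2 := by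
    intro η hη
    obtain ⟨ε, hε, L₀, hL⟩ := hZ η hη
    refine ⟨ε, hε, L₀, fun L _ hE hL₀ => le_trans (Finset.sum_le_sum fun m _ => ?_) (hL L hE hL₀)⟩
    by_cases hm : m ≠ 0 ∧ momentumNormSq L m ≤ ε ^ 2
    · rw [if_pos hm, if_pos hm.2]
    · rw [if_neg hm]
      split_ifs
      · exact pairStructureFactor_nonneg _ _ _ _
      · exact le_rfl
  -- (ii) hence pair-field long-range order along the even sides (landed exchange lemma + atom property)
  have hLRO : HasLongRangeOrder (fun k => halfOpenBox 2 (2 * k))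
      (fun k => torusPullback (pairFieldCorr dWaveFormFactor ψ) (2 * k)) :=
    infiniteVolumeFirst_tightnessExchange_proof ψ (fun L _ => (hψ L).1) htight (hA _ ψ hadm)
  -- the long-range-order sequence
  obtain ⟨u, hu⟩ : ∃ u : ℕ → ℝ, ∀ L, u L = (∑ x ∈ halfOpenBox 2 L, ∑ y ∈ halfOpenBox 2 L,
      torusPullback (pairFieldCorr dWaveFormFactor ψ) L x y) / ((halfOpenBox 2 L).card : ℝ) ^ 2 :=
    ⟨_, fun _ => rfl⟩
  have hgoal : HasLongRangeOrder (fun k => halfOpenBox 2 (2 * k))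
      (fun k => torusPullback (pairFieldCorr dWaveFormFactor ψ) (2 * k)) ↔
      0 < liminf (fun k => u (2 * k)) atTop := by
    simp only [HasLongRangeOrder, hu]
  rw [hgoal] at hLRO
  have hu0 : ∀ k, 0 ≤ u (2 * k) := fun k => by
    rw [hu]; exact tightnessExchange_lroSeq_nonneg ψ _
  -- (iii) but the zero mode lies in every window: `LRO_{2k} = S_{2k}(0)/(2k)² ≤ η` eventually
  have hev : ∀ η : ℝ, 0 < η → ∀ᶠ k : ℕ in atTop, u (2 * k) ≤ η := by
    intro η hη
    obtain ⟨ε, hε, L₀, hL⟩ := hZ η hη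
    refine eventually_atTop.2 ⟨L₀ + 1, fun k hk => ?_⟩
    obtain ⟨n, hn⟩ : ∃ n : ℕ, 2 * k = n + 1 := ⟨2 * k - 1, by omega⟩
    rw [hu, hn, torusLROSeq_pairFieldCorr_succ]
    have hw := hL (n + 1) ⟨k, by omega⟩ (by omega)
    have h0 := pairStructureFactor_zero_le_windowSumWithZero (n + 1) ε (ψ (n + 1))
    rw [pairStructureFactor_zero] at h0
    have hLpos : (0 : ℝ) < ((n + 1 : ℕ) : ℝ) := by positivity
    have hL2 : (0 : ℝ) < ((n + 1 : ℕ) : ℝ) ^ 2 := by positivity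
    have hL4 : (0 : ℝ) < ((n + 1 : ℕ) : ℝ) ^ 4 := by positivity
    rw [div_le_iff₀ hL2] at h0
    rw [div_le_iff₀ hL4]
    have hmul := mul_le_mul_of_nonneg_right hw hL2.le
    have h4 : η * ((n + 1 : ℕ) : ℝ) ^ 2 * ((n + 1 : ℕ) : ℝ) ^ 2 = η * ((n + 1 : ℕ) : ℝ) ^ 4 := by ring
    linarith [h0, hmul, h4]
  have hle : ∀ η : ℝ, 0 < η → liminf (fun k => u (2 * k)) atTop ≤ η := fun η hη =>
    liminf_le_of_frequently_le (hev η hη).frequently (isBoundedUnder_of ⟨0, fun k => hu0 k⟩)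
  have hlim0 : liminf (fun k => u (2 * k)) atTop ≤ 0 :=
    le_of_forall_pos_le_add fun η hη => by rw [zero_add]; exact hle η hη
  exact absurd hLRO (not_lt.2 hlim0)

end Summit.HubbardSuperconductivity.HubbardSuperconductivity.Theorems.NoInfraredPileUp.Negative
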